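import Literature.NumberTheory.Weil1964.RealWeilIndexSignature
import Literature.LinearAlgebra.QuadraticForm.MaslovIndex
import HarnessLib

/-!
# The Weil index of Kashiwara's form: `e^{iπ τ(ℓ₁,ℓ₂,ℓ₃)/4} = γ(f_Q)`

Topic `NumberTheory/Weil1964`; namespace `Literature.NumberTheory.Weil1964`. KERNEL mathematics only
(theorems; no definition, no named fact, no `axiom`, no `sorry`). Joins `RealWeilIndexSignature.lean`
(`realWeilIndexSymm hS = e^{iπ (sigPos Q_S - sigNeg Q_S)/4}`, [Weil1964, Chap. II n° 26]) with
`Literature/LinearAlgebra/QuadraticForm/MaslovIndex.lean` (Kashiwara's `τ = sigPos Q - sigNeg Q`,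
[LionVergne1980, §1.5.1]).

* (private) `toQuadraticForm'_toMatrix'`, `isHermitian_toMatrix'` — a quadratic form on `ℝ^ι` is the form of
  its Gram matrix, which is symmetric (Mathlib round trip; the hypothesis `hS` below is always inhabited, see the
  `exists_…` forms);
* `realWeilIndexSymm_toMatrix'` — for ANY real quadratic form `Q` on `ℝ^ι`, the Weil index of the character
  `e^{2πi Q}` (through the Gram matrix `Q.toMatrix'`) is `e^{iπ (sigPos Q - sigNeg Q)/4}`; `realWeilIndexSymm_basisRepr`
  — the same for a form on an abstract finite-dimensional real space in any basis (the index does not depend on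
  the basis: [Weil1964, Chap. II n° 25] "`γ` a même valeur pour deux formes équivalentes");
* **`realWeilIndexSymm_kashiwaraForm`** — for a bilinear form `B` on a real vector space and three
  finite-dimensional subspaces, in any basis `b` of `ℓ₁ × ℓ₂ × ℓ₃`:
  `γ(e^{2πi Q_{Kashiwara}}) = e^{iπ τ(ℓ₁, ℓ₂, ℓ₃)/4}` — the eighth root of unity by which the Maslov index
  enters the metaplectic cocycle at a real place ([LionVergne1980, §1.5.1 with §1.7]; [Weil1964, n° 26]
  "dans tous les cas, `γ(f)` est une racine huitième de l'unité").

## References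

* [Weil1964] A. Weil, *Sur certains groupes d'opérateurs unitaires*, Acta Math. 111 (1964), Chap. II n° 25–26
  (pp. 173–174).
* [LionVergne1980] G. Lion, M. Vergne, *The Weil representation, Maslov index and Theta series*, Progress in
  Mathematics 6 (1980), Part I §1.5.1.
-/

set_option autoImplicit false

noncomputable section

open MeasureTheory Complex Filter Topology Set Finset QuadraticMap
open scoped Real BigOperators ComplexConjugate Matrix

namespace Literature.NumberTheory.Weil1964

variable {ι : Type*} [Fintype ι] [DecidableEq ι]

/-- a real quadratic form on `ℝ^ι` is the form `xᵀ S x` of its (symmetric) Gram matrix `S = Q.toMatrix'`.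
[folklore] -/
private theorem toQuadraticForm'_toMatrix' (Q : QuadraticForm ℝ (ι → ℝ)) : Q.toMatrix'.toQuadraticForm' = Q := by
  conv_rhs => rw [← Q.toQuadraticMap_associated ℝ, ← (LinearMap.toMatrix₂' ℝ).left_inv (Q.associatedHom ℝ)]
  rfl

/-- the Gram matrix of a real quadratic form is symmetric (the hypothesis `hS` of the theorems below is
always available: `Matrix.isHermitian_iff_isSymm.2 Q.isSymm_toMatrix'`). [folklore] -/
private theorem isHermitian_toMatrix' (Q : QuadraticForm ℝ (ι → ℝ)) : Q.toMatrix'.IsHermitian :=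
  Matrix.isHermitian_iff_isSymm.2 (QuadraticForm.isSymm_toMatrix' Q)

/-- **the Weil index of the character `e^{2πi Q(x)}` of ANY real quadratic form `Q` on `ℝ^ι` is
`e^{iπ (sigPos Q - sigNeg Q)/4}`** (Sylvester's canonical inertia; degenerate forms allowed).
[cite: Weil1964, Chap. II n° 26, pp. 173–174] -/
theorem realWeilIndexSymm_toMatrix' (Q : QuadraticForm ℝ (ι → ℝ)) (hS : Q.toMatrix'.IsHermitian) :
    realWeilIndexSymm hS =
      cexp (((π / 4 * ((sigPos Q : ℝ) - (sigNeg Q : ℝ)) : ℝ) : ℂ) * I) := by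
  rw [realWeilIndexSymm_eq_cexp_sigPos_sub_sigNeg, toQuadraticForm'_toMatrix']

/-- the character of the Gram matrix is `e^{2πi Q}`. [cite: Weil1964, Chap. II n° 26, p. 173] -/
theorem symmChirp_toMatrix' (Q : QuadraticForm ℝ (ι → ℝ)) (x : ι → ℝ) :
    symmChirp Q.toMatrix' x = cexp (2 * π * I * ((Q x : ℝ) : ℂ)) := by
  rw [symmChirp_eq_cexp_toQuadraticForm', toQuadraticForm'_toMatrix']

/-- **basis independence**: for a quadratic form `Q` on a finite-dimensional real space `M` and any basis
`b`, the Weil index of the Gram matrix of `Q` in `b` is `e^{iπ (sigPos Q - sigNeg Q)/4}` ("`γ` a même valeur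
pour deux formes équivalentes"). [cite: Weil1964, Chap. II n° 25–26, p. 173] -/
theorem realWeilIndexSymm_basisRepr {M : Type*} [AddCommGroup M] [Module ℝ M] (Q : QuadraticForm ℝ M)
    (b : Module.Basis ι ℝ M) (hS : (QuadraticForm.toMatrix' (Q.basisRepr b)).IsHermitian) :
    realWeilIndexSymm hS = cexp (((π / 4 * ((sigPos Q : ℝ) - (sigNeg Q : ℝ)) : ℝ) : ℂ) * I) := by
  have h : Q.Equivalent (Q.basisRepr b) := ⟨QuadraticMap.isometryEquivBasisRepr Q b⟩
  rw [realWeilIndexSymm_toMatrix', h.sigPos_eq, h.sigNeg_eq]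

/-- hypothesis-free form of `realWeilIndexSymm_basisRepr`: the Gram matrix in any basis IS symmetric and its
Weil index is `e^{iπ (sigPos Q - sigNeg Q)/4}`. [cite: Weil1964, Chap. II n° 25–26, p. 173] -/
theorem exists_realWeilIndexSymm_basisRepr {M : Type*} [AddCommGroup M] [Module ℝ M] (Q : QuadraticForm ℝ M)
    (b : Module.Basis ι ℝ M) :
    ∃ hS : (QuadraticForm.toMatrix' (Q.basisRepr b)).IsHermitian,
      realWeilIndexSymm hS = cexp (((π / 4 * ((sigPos Q : ℝ) - (sigNeg Q : ℝ)) : ℝ) : ℂ) * I) :=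
  ⟨isHermitian_toMatrix' _, realWeilIndexSymm_basisRepr Q b _⟩

/-- **the Weil index of Kashiwara's form is `e^{iπ τ/4}`**: for a bilinear form `B` on a real vector space,
three subspaces `ℓ₁, ℓ₂, ℓ₃` with `ℓ₁ × ℓ₂ × ℓ₃` finite-dimensional, and any basis `b` of `ℓ₁ × ℓ₂ × ℓ₃`,
the index of the second-degree character `e^{2πi Q}` of `Q(x₁,x₂,x₃) = B(x₁,x₂) + B(x₂,x₃) + B(x₃,x₁)`
(through its Gram matrix in `b`) equals `e^{iπ τ(ℓ₁,ℓ₂,ℓ₃)/4}`, `τ` the Maslov index.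
[cite: LionVergne1980, §1.5.1; Weil1964, Chap. II n° 26, p. 174] -/
theorem realWeilIndexSymm_kashiwaraForm {V : Type*} [AddCommGroup V] [Module ℝ V]
    (B : LinearMap.BilinForm ℝ V) (ℓ₁ ℓ₂ ℓ₃ : Submodule ℝ V) (b : Module.Basis ι ℝ (ℓ₁ × ℓ₂ × ℓ₃))
    (hS : (QuadraticForm.toMatrix'
      ((Literature.LinearAlgebra.QuadraticForm.kashiwaraForm B ℓ₁ ℓ₂ ℓ₃).basisRepr b)).IsHermitian) :
    realWeilIndexSymm hS =
      cexp (((π / 4 * (Literature.LinearAlgebra.QuadraticForm.maslovIndex B ℓ₁ ℓ₂ ℓ₃ : ℝ) : ℝ) : ℂ) * I) := by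
  rw [realWeilIndexSymm_basisRepr, Literature.LinearAlgebra.QuadraticForm.maslovIndex_eq]
  push_cast
  ring_nf

/-- hypothesis-free form of `realWeilIndexSymm_kashiwaraForm`: in any basis the Gram matrix of Kashiwara's
form is symmetric and its Weil index is `e^{iπ τ(ℓ₁,ℓ₂,ℓ₃)/4}`.
[cite: LionVergne1980, §1.5.1; Weil1964, Chap. II n° 26, p. 174] -/
theorem exists_realWeilIndexSymm_kashiwaraForm {V : Type*} [AddCommGroup V] [Module ℝ V]
    (B : LinearMap.BilinForm ℝ V) (ℓ₁ ℓ₂ ℓ₃ : Submodule ℝ V) (b : Module.Basis ι ℝ (ℓ₁ × ℓ₂ × ℓ₃)) :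
    ∃ hS : (QuadraticForm.toMatrix'
      ((Literature.LinearAlgebra.QuadraticForm.kashiwaraForm B ℓ₁ ℓ₂ ℓ₃).basisRepr b)).IsHermitian,
      realWeilIndexSymm hS =
        cexp (((π / 4 * (Literature.LinearAlgebra.QuadraticForm.maslovIndex B ℓ₁ ℓ₂ ℓ₃ : ℝ) : ℝ) : ℂ) * I) :=
  ⟨isHermitian_toMatrix' _, realWeilIndexSymm_kashiwaraForm B ℓ₁ ℓ₂ ℓ₃ b _⟩

end Literature.NumberTheory.Weil1964
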